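import Literature.Barriers.CriticalPhenomena.PlaquetteWalkKissChains
import Literature.Barriers.CriticalPhenomena.PlaquetteWalkHoleRootNoVerticalEnd
import Literature.Barriers.CriticalPhenomena.PlaquetteWalkHoleRootInitialRun
import HarnessLib

/-!
# Barrier catalogue (SAWScalingLimit): NO DOUBLY VISITED PLAQUETTE in a wound cost-`5` class-`B2a` walk at a root-row rhombus («NO KISS AT COST FIVE»)

`Z → ∞` limit model of the printed Yang–Baxter weights [GlazmanManolescu2019, §1, eq. (1)]; the «RECTANGLE COEFFICIENT» line of the venture
lane «pcv-sawmu» (b-engine-1 g26). This is (R2) for the cost-`5` members, the structural hypothesis `hR2` (first disjunct) of the ROOT-ROW LAW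
`PlaquetteWalkHoleRootRowLaw.vertexFunctional_printed_zero_set_finite_of_noDoubleVisit`; the lane's census (kits j276221, j280313:
`n_{w₁} = n_{w₂} = 0` for every wound member of limit cost `5`) becomes a theorem.

★★★★ `ΩG.injective_of_cost_five`. Let `ω` be a class-`B2a` walk from the hole root `w.side W` (hole `(w.1 − 1, w.2)` absent) at a rhombus
`r` of the ROOT ROW east of the hole (`r.2 = w.2`, `w.1 ≤ r.1`), WOUND (`A_J ≠ 0`) and of limit cost `5`. Then no plaquette carries two arcs.
Proof (CHAIN CALCULUS, `PlaquetteWalkKissChains`; no winding numbers beyond the tree's profile lemmas): a doubly visited plaquette `κ` uses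
its four sides; its eastward chain ends at an isolated turn `τ` in the row of `κ`, a middle row (extreme rows are singly visited), so `τ`
is THE middle isolated turn of the cost-`5` profile (#824: at most one) and the westward chain must end at the root plaquette `w`: `κ`
lies on the root row. Its vertical chains end at isolated turns `(κ.1, Y)`, `(κ.1, Y')` in the extreme rows (the alternative end «next to
`r` at the walk's last arc» is excluded by `r.2 = w.2`), the vertical chain of `τ` ends at `(τ.1, Y)` or `(τ.1, Y')`, and the entry turn
of the leftmost column `X ≤ w.1 − 2` (#838) is a fifth isolated turn. These five exhaust `n_{u₁} + n_{u₂} = 5`; but the horizontal chain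
of `(κ.1, Y')` (resp. `(κ.1, Y)`) inside its extreme row needs a partner turn there, which can only be the left entry turn, whose own
vertical chain then needs a sixth isolated turn in column `X` — or ends next to `r`, putting `r` in column `X < w.1`.
[GlazmanManolescu2019 §1 Fig. 1, eq. (1), Lemma 2.1, Remark 2.2; Glazman2015WeightedSAW Lemma 3.1 (proof, pp. 6–7); CourantRobbins1958 Ch. V App. §2]
-/

noncomputable section

namespace Literature.Probability.RandomPlanarGeometry.SAW.YangBaxter

open Real
open Literature.Barriers.CriticalPhenomena.PlaquetteWalk

open private fc_fh fh_add_Mv three_le_Mv from Literature.Probability.RandomPlanarGeometry.YangBaxterSAWGeneralDomain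

namespace ΩG

variable {D : Set Face} {w r : Face} {ω : ΩG D (w.side .W) r}

/-- The last arc of a walk returning to the `N` or `S` side of `r` leaves its plaquette vertically. [cite: GlazmanManolescu2019, §1, Fig. 1] -/
theorem sOut_last_NS_of_slanted (h : ω.IsB2a) (hz : ω.1 = .N ∨ ω.1 = .S) :
    ω.2.sOut (ω.2.arcs.length - 1) = .N ∨ ω.2.sOut (ω.2.arcs.length - 1) = .S := by
  have hlen : 0 < ω.2.arcs.length := by have := ω.fh_lt h; omega
  obtain ⟨-, hout⟩ := ω.2.side_sIn_eq_nth (show ω.2.arcs.length - 1 < ω.2.arcs.length by omega)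
  rw [show ω.2.arcs.length - 1 + 1 = ω.2.arcs.length by omega, ω.2.nth_length] at hout
  rcases hfc : ω.2.fc (ω.2.arcs.length - 1) with ⟨x, y⟩
  rw [hfc] at hout
  generalize hs : ω.2.sOut (ω.2.arcs.length - 1) = s at hout ⊢
  generalize ht : ω.1 = t at hout hz
  rcases hz with rfl | rfl <;> cases s <;> simp [Face.side] at hout ⊢

/-- The last plaquette of a class-`B2a` walk is not the rooted rhombus. [cite: GlazmanManolescu2019, Lemma 2.1 (the classes of walks through a rhombus)] -/
theorem fc_last_ne_root (hr : RootedFace D (w.side .W) r) (h : ω.IsB2a) : ω.2.fc (ω.2.arcs.length - 1) ≠ r := by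
  intro e
  have hlen : 0 < ω.2.arcs.length := by have := ω.fh_lt h; omega
  have hfcF := (fc_fh ω hr h).1
  have := eq_firstHitG_of_fc_eq hr h (show ω.2.arcs.length - 1 < ω.2.arcs.length by omega) (e.trans hfcF.symm)
  have := three_le_Mv hr h; have := fh_add_Mv h; unfold ΩG.Mv at *; omega

/-- ★★★★ **NO DOUBLY VISITED PLAQUETTE AT LIMIT COST `5` (root row).** A wound class-`B2a` walk of limit cost `5` from the hole root `w.side W`
(hole `(w.1 − 1, w.2)` absent) at a rhombus `r` of the root row east of the hole (`r.2 = w.2`, `w.1 ≤ r.1`) visits no plaquette twice: its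
plaquette map is injective (`n_{w₁} = n_{w₂} = 0`). [cite: GlazmanManolescu2019, §1, Fig. 1 and eq. (1); Lemma 2.1; Remark 2.2]
[cite: Glazman2015WeightedSAW, Lemma 3.1 (proof, pp. 6–7)] [cite: CourantRobbins1958, Ch. V Appendix §2 (the even–odd rule)] -/
theorem injective_of_cost_five (hh : holeFaceW w ∉ D) (hr : RootedFace D (w.side .W) r) (h : ω.IsB2a)
    (hA : ω.AJ hr h (toC (midPt (w.side .W))) ≠ 0) (hc : cost (slotOfSide ω.1) ω.2.mids = 5) (hrow : r.2 = w.2) (hcol : w.1 ≤ r.1) :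
    ∀ i j, i < ω.2.arcs.length → j < ω.2.arcs.length → ω.2.fc i = ω.2.fc j → i = j := by
  classical
  intro i j hi hj he
  by_contra hij
  set n := ω.2.arcs.length with hn
  -- the doubly visited plaquette `κ` uses all four sides
  set κ := ω.2.fc i with hκ
  have hκall : ∀ s, ω.2.UsesSide κ s := fun s => ω.2.usesSide_of_fc_eq hi hj hij he s
  -- ends: the first arc enters `w` through `W`, the last arc leaves vertically
  have hz := end_slanted_of_cost_five hh hr h hA hc
  have hd : slotDeg (slotOfSide ω.1) = 1 := by rcases hz with e | e <;> rw [e] <;> rfl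
  have hlen : 0 < n := by omega
  have h0w : ω.2.fc 0 = w := fc_zero_eq_root w hh ω.2 hlen
  have h0W : ω.2.sIn 0 = .W := YBWalk.sIn_zero_eq_W hh ω.2 hlen
  have h0E : ω.2.sIn 0 ≠ .E := by rw [h0W]; decide
  have h0N : ω.2.sIn 0 ≠ .N := by rw [h0W]; decide
  have h0S : ω.2.sIn 0 ≠ .S := by rw [h0W]; decide
  have hlast := sOut_last_NS_of_slanted h hz
  have hzE : ω.2.sOut (n - 1) ≠ .E := by rcases hlast with e | e <;> rw [e] <;> decide
  have hzW : ω.2.sOut (n - 1) ≠ .W := by rcases hlast with e | e <;> rw [e] <;> decide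
  have hlastr := fc_last_ne_root hr h
  -- the mid-edge after the last arc is the end `z = r.side ω.1`
  have hzside : (ω.2.fc (n - 1)).side (ω.2.sOut (n - 1)) = r.side ω.1 := by
    obtain ⟨-, hout⟩ := ω.2.side_sIn_eq_nth (show n - 1 < n by omega)
    rwa [show n - 1 + 1 = n by omega, ω.2.nth_length] at hout
  -- if the last arc leaves `(x, y)` through `N` (resp. `S`) then `r = (x, y + 1)` (resp. `(x, y − 1)`)
  have hZN : ∀ x y : ℤ, ω.2.fc (n - 1) = (x, y) → ω.2.sOut (n - 1) = .N → r = (x, y + 1) := by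
    intro x y hfc hN
    rw [hfc, hN] at hzside
    rcases hz with e | e <;> rw [e] at hzside
    · exfalso; refine hlastr ?_
      rcases r with ⟨r1, r2⟩
      simp only [Face.side, MidEdge.slant.injEq] at hzside
      rw [hfc]; simp only [Prod.mk.injEq]; omega
    · rcases r with ⟨r1, r2⟩
      simp only [Face.side, MidEdge.slant.injEq] at hzside
      simp only [Prod.mk.injEq]; omega
  have hZS : ∀ x y : ℤ, ω.2.fc (n - 1) = (x, y) → ω.2.sOut (n - 1) = .S → r = (x, y - 1) := by
    intro x y hfc hS
    rw [hfc, hS] at hzside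
    rcases hz with e | e <;> rw [e] at hzside
    · rcases r with ⟨r1, r2⟩
      simp only [Face.side, MidEdge.slant.injEq] at hzside
      simp only [Prod.mk.injEq]; omega
    · exfalso; refine hlastr ?_
      rcases r with ⟨r1, r2⟩
      simp only [Face.side, MidEdge.slant.injEq] at hzside
      rw [hfc]; simp only [Prod.mk.injEq]; omega
  -- the profile: extreme rows `Y' < w.2 < Y`, at most one isolated turn strictly between, five isolated turns in all
  obtain ⟨Y, Y', hY'w, hYw, hY, hY', hprof, -⟩ := turn_profile_of_cost_five hh hr h hA hc
  have h5 := (isolated_eq_five_of_cost_five hh hr h hA hc).1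
  let P : Face → Prop := fun f => f ∈ facesL ω.2.mids ∧ (kindsL ω.2.mids f = [.corner] ∨ kindsL ω.2.mids f = [.coCorner])
  have hPiso : ∀ k < n, (∀ l < n, ω.2.fc l = ω.2.fc k → l = k) → arcKind (ω.2.sIn k) (ω.2.sOut k) ≠ .straight → P (ω.2.fc k) :=
    fun k hk hsv hkind => isolated_turn hk hsv hkind
  have hmid1 : ∀ f g, P f → P g → Y' < f.2 → f.2 < Y → Y' < g.2 → g.2 < Y → f = g := by
    intro f g hf hg h1 h2 h3 h4
    by_contra hne
    have := (hprof {f, g} (fun x hx => by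
      simp only [Finset.mem_insert, Finset.mem_singleton] at hx
      rcases hx with rfl | rfl
      · exact hf
      · exact hg)).2.2 (fun x hx => by
      simp only [Finset.mem_insert, Finset.mem_singleton] at hx
      rcases hx with rfl | rfl
      · exact ⟨h1, h2⟩
      · exact ⟨h3, h4⟩)
    rw [Finset.card_insert_of_notMem (by simpa using hne), Finset.card_singleton, hd] at this
    omega
  have hle5 : ∀ T : Finset Face, (∀ f ∈ T, P f) → T.card ≤ 5 := by
    intro T hT
    have := YBWalk.card_le_cfgCount_add ω.2.mids T hT
    omega
  -- the extreme columns
  obtain ⟨X, hXw, hX, sL, -, hsL, hcolL, -, hinL, houtL⟩ := exists_left_entry_turn hh hr h hA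
  obtain ⟨X', -, hX', -⟩ := exists_right_entry_turn hh hr h
  have hsvσ : ∀ l < n, ω.2.fc l = ω.2.fc sL → l = sL :=
    fun l hl e => (left_single_visit hh hr h hX (by omega) hsL hl hcolL e.symm).symm
  have hPσ : P (ω.2.fc sL) := hPiso sL hsL hsvσ (by rw [hinL]; rcases houtL with e | e <;> rw [e] <;> decide)
  -- single visits in the extreme rows; no `N` side used in the top row, no `S` side in the bottom row
  have hNtop := forall_top_ne_N hh hr h hY hYw
  have hSbot := forall_bottom_ne_S hh hr h hY' hY'w
  -- `κ` lies strictly between the extreme rows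
  have hκY : κ.2 < Y := lt_of_le_of_ne (hY i hi) (fun e => hij (top_single_visit hh hr h hY hYw hi hj e he))
  have hκY' : Y' < κ.2 := lt_of_le_of_ne (hY' i hi) (fun e => hij (bottom_single_visit hh hr h hY' hY'w hi hj e.symm he))
  ---------------------------------------------------------------- the horizontal chain of `κ`: east end `τ`
  obtain ⟨M, hWall, -, hend_M⟩ := ω.2.chain_E hX' (hκall .E)
  rcases hend_M with ⟨hM1, hnotE⟩ | ⟨-, hs0⟩ | ⟨-, hsZ⟩
  rotate_left
  · exact absurd hs0 h0E
  · exact absurd hsZ hzE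
  obtain ⟨iτ, hiτ, hfcτ, hsvτ, hWτ, hninτ, hnoutτ, hkτ⟩ := ω.2.isolated_of_usesSide_not_opp (hWall M hM1 le_rfl) hnotE
  have hPτ : P (κ.1 + M, κ.2) := by rw [← hfcτ]; exact hPiso iτ hiτ hsvτ hkτ
  -- west end: an isolated turn (a second middle one: impossible) or the root plaquette `w`
  obtain ⟨M', hEall', -, hend'⟩ := ω.2.chain_W hX (hκall .W)
  have hκrow : κ.2 = w.2 ∧ w.1 ≤ κ.1 := by
    rcases hend' with ⟨hM'1, hnotW⟩ | ⟨hA0, -⟩ | ⟨-, hsZ⟩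
    rotate_right
    · exact absurd hsZ hzW
    · exfalso
      obtain ⟨i', hi', hfc', hsv', -, -, -, hk'⟩ := ω.2.isolated_of_usesSide_not_opp (hEall' M' hM'1 le_rfl) hnotW
      have hP' : P (κ.1 - M', κ.2) := by rw [← hfc']; exact hPiso i' hi' hsv' hk'
      have := hmid1 _ _ hP' hPτ hκY' hκY hκY' hκY
      have := congrArg Prod.fst this; simp only at this; omega
    · rw [h0w] at hA0
      have h1 := congrArg Prod.fst hA0; have h2 := congrArg Prod.snd hA0; simp only at h1 h2
      constructor <;> omega
  obtain ⟨hκ2, hκ1⟩ := hκrow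
  have hXκ : X < κ.1 := by omega
  ---------------------------------------------------------------- the vertical chains of `κ`: `(κ.1, Y)` and `(κ.1, Y')`
  obtain ⟨Mu, hSu, -, hendu⟩ := ω.2.chain_N hY (hκall .N)
  have hTop : (Mu : ℤ) = Y - w.2 ∧ ω.2.UsesSide (κ.1, Y) .S ∧ ¬ω.2.UsesSide (κ.1, Y) .N := by
    rcases hendu with ⟨hMu1, hnotN⟩ | ⟨-, hs0⟩ | ⟨hZ, hNo⟩
    rotate_left
    · exact absurd hs0 h0N
    rotate_right
    · obtain ⟨i', hi', hfc', hsv', -, -, -, hk'⟩ := ω.2.isolated_of_usesSide_not_opp (hSu Mu hMu1 le_rfl) hnotN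
      have hP' : P (κ.1, κ.2 + Mu) := by rw [← hfc']; exact hPiso i' hi' hsv' hk'
      have hle : κ.2 + Mu ≤ Y := by have := hY i' hi'; rw [hfc'] at this; exact this
      rcases lt_or_eq_of_le hle with hlt | heq
      · exfalso
        have := hmid1 _ _ hP' hPτ (by simp only; omega) hlt hκY' hκY
        have := congrArg Prod.fst this; simp only at this; omega
      · have eY : κ.2 + (Mu : ℤ) = Y := heq
        refine ⟨by omega, ?_, ?_⟩
        · have := hSu Mu hMu1 le_rfl; rwa [eY] at this
        · rwa [eY] at hnotN
    · exfalso
      -- the walk would end above the chain, at `r = (κ.1, κ.2 + Mu + 1)`, off the root row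
      have hr' := hZN κ.1 (κ.2 + Mu) hZ.symm hNo
      have := congrArg Prod.snd hr'; simp only at this; omega
  obtain ⟨hMuY, hTopS, hTopN⟩ := hTop
  obtain ⟨Md, hNd, -, hendd⟩ := ω.2.chain_S hY' (hκall .S)
  have hBot : (Md : ℤ) = w.2 - Y' ∧ ω.2.UsesSide (κ.1, Y') .N ∧ ¬ω.2.UsesSide (κ.1, Y') .S := by
    rcases hendd with ⟨hMd1, hnotS⟩ | ⟨-, hs0⟩ | ⟨hZ, hSo⟩
    rotate_left
    · exact absurd hs0 h0S
    rotate_right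
    · obtain ⟨i', hi', hfc', hsv', -, -, -, hk'⟩ := ω.2.isolated_of_usesSide_not_opp (hNd Md hMd1 le_rfl) hnotS
      have hP' : P (κ.1, κ.2 - Md) := by rw [← hfc']; exact hPiso i' hi' hsv' hk'
      have hle : Y' ≤ κ.2 - Md := by have := hY' i' hi'; rw [hfc'] at this; exact this
      rcases lt_or_eq_of_le hle with hlt | heq
      · exfalso
        have := hmid1 _ _ hP' hPτ hlt (by simp only; omega) hκY' hκY
        have := congrArg Prod.fst this; simp only at this; omega
      · have eY : κ.2 - (Md : ℤ) = Y' := heq.symm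
        refine ⟨by omega, ?_, ?_⟩
        · have := hNd Md hMd1 le_rfl; rwa [eY] at this
        · rwa [eY] at hnotS
    · exfalso
      have hr' := hZS κ.1 (κ.2 - Md) hZ.symm hSo
      have := congrArg Prod.snd hr'; simp only at this; omega
  obtain ⟨hMdY, hBotN, hBotS⟩ := hBot
  obtain ⟨iT, hiT, hfcT, hsvT, hST, hninT, hnoutT, hkT⟩ := ω.2.isolated_of_usesSide_not_opp hTopS hTopN
  obtain ⟨iB, hiB, hfcB, hsvB, hNB, hninB, hnoutB, hkB⟩ := ω.2.isolated_of_usesSide_not_opp hBotN hBotS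
  have hPT : P (κ.1, Y) := by rw [← hfcT]; exact hPiso iT hiT hsvT hkT
  have hPB : P (κ.1, Y') := by rw [← hfcB]; exact hPiso iB hiB hsvB hkB
  -- the left entry turn lies in an extreme row
  have hσrow : (ω.2.fc sL).2 = Y ∨ (ω.2.fc sL).2 = Y' := by
    have h1 := hY sL hsL; have h2 := hY' sL hsL
    by_contra hno
    push Not at hno
    have := hmid1 _ _ hPσ hPτ (lt_of_le_of_ne h2 (fun e => hno.2 e.symm)) (lt_of_le_of_ne h1 hno.1) hκY' hκY
    have := congrArg Prod.fst this; rw [hcolL] at this; simp only at this; omega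
  -- `τ` uses `N` or `S`
  have hτNS : ω.2.UsesSide (κ.1 + M, κ.2) .N ∨ ω.2.UsesSide (κ.1 + M, κ.2) .S := by
    have hne := ω.2.sIn_ne_sOut hiτ
    have key : (ω.2.sIn iτ = .N ∨ ω.2.sOut iτ = .N) ∨ (ω.2.sIn iτ = .S ∨ ω.2.sOut iτ = .S) := by
      revert hWτ hninτ hnoutτ hne
      cases ω.2.sIn iτ <;> cases ω.2.sOut iτ <;> decide
    rcases key with hN | hS
    · exact Or.inl ⟨iτ, hiτ, hfcτ, hN⟩
    · exact Or.inr ⟨iτ, hiτ, hfcτ, hS⟩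
  rcases hτNS with hτN | hτS
  · ------------------------------------------------------------ CASE `τ` uses `N`: its chain climbs to `(τ.1, Y)`
    obtain ⟨Mt, hSt, -, hendt⟩ := ω.2.chain_N hY hτN
    have hτ' : ω.2.UsesSide (κ.1 + M, Y) .S ∧ ¬ω.2.UsesSide (κ.1 + M, Y) .N := by
      rcases hendt with ⟨hMt1, hnotN⟩ | ⟨-, hs0⟩ | ⟨hZ, hNo⟩
      rotate_left
      · exact absurd hs0 h0N
      rotate_right
      · obtain ⟨i', hi', hfc', hsv', -, -, -, hk'⟩ := ω.2.isolated_of_usesSide_not_opp (hSt Mt hMt1 le_rfl) hnotN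
        have hP' : P (κ.1 + M, κ.2 + Mt) := by rw [← hfc']; exact hPiso i' hi' hsv' hk'
        have hle : κ.2 + Mt ≤ Y := by have := hY i' hi'; rw [hfc'] at this; exact this
        rcases lt_or_eq_of_le hle with hlt | heq
        · exfalso
          have := hmid1 _ _ hP' hPτ (by simp only; omega) hlt hκY' hκY
          have := congrArg Prod.snd this; simp only at this; omega
        · have eY : κ.2 + (Mt : ℤ) = Y := heq
          simp only at hnotN
          exact ⟨by have := hSt Mt hMt1 le_rfl; simp only at this; rwa [eY] at this, by rwa [eY] at hnotN⟩
      · exfalso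
        simp only at hZ
        have hr' := hZN (κ.1 + M) (κ.2 + Mt) hZ.symm hNo
        have := congrArg Prod.snd hr'; simp only at this; omega
    obtain ⟨iτ', hiτ', hfcτ', hsvτ', -, -, -, hkτ'⟩ := ω.2.isolated_of_usesSide_not_opp hτ'.1 hτ'.2
    have hPτ' : P (κ.1 + M, Y) := by rw [← hfcτ']; exact hPiso iτ' hiτ' hsvτ' hkτ'
    -- the five isolated turns
    let S5 : Finset Face := {(κ.1 + M, κ.2), (κ.1, Y), (κ.1, Y'), (κ.1 + M, Y), ω.2.fc sL}
    have hS5P : ∀ f ∈ S5, P f := by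
      intro f hf
      simp only [S5, Finset.mem_insert, Finset.mem_singleton] at hf
      rcases hf with rfl | rfl | rfl | rfl | rfl
      · exact hPτ
      · exact hPT
      · exact hPB
      · exact hPτ'
      · exact hPσ
    have hS5card : S5.card = 5 := by
      have hσ1 := hcolL
      simp only [S5]
      rw [Finset.card_insert_of_notMem, Finset.card_insert_of_notMem, Finset.card_insert_of_notMem,
        Finset.card_insert_of_notMem, Finset.card_singleton]
      · simp only [Finset.mem_singleton]
        intro e; have := congrArg Prod.fst e; simp only at this; omega
      · simp only [Finset.mem_insert, Finset.mem_singleton, Prod.mk.injEq, not_or]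
        refine ⟨by omega, fun e => ?_⟩
        have := congrArg Prod.fst e; simp only at this; omega
      · simp only [Finset.mem_insert, Finset.mem_singleton, Prod.mk.injEq, not_or]
        refine ⟨by omega, by omega, fun e => ?_⟩
        have := congrArg Prod.fst e; simp only at this; omega
      · simp only [Finset.mem_insert, Finset.mem_singleton, Prod.mk.injEq, not_or]
        refine ⟨by omega, by omega, by omega, fun e => ?_⟩
        have := congrArg Prod.fst e; simp only at this; omega
    have hall : ∀ f, P f → f ∈ S5 := by
      intro f hf
      by_contra hnot
      have := hle5 (insert f S5) (fun g hg => by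
        rcases Finset.mem_insert.1 hg with rfl | hg
        · exact hf
        · exact hS5P g hg)
      rw [Finset.card_insert_of_notMem hnot, hS5card] at this
      omega
    -- the bottom turn `(κ.1, Y')` uses `E` or `W`
    have hBEW : ω.2.UsesSide (κ.1, Y') .E ∨ ω.2.UsesSide (κ.1, Y') .W := by
      have hne := ω.2.sIn_ne_sOut hiB
      have key : (ω.2.sIn iB = .E ∨ ω.2.sOut iB = .E) ∨ (ω.2.sIn iB = .W ∨ ω.2.sOut iB = .W) := by
        revert hNB hninB hnoutB hne
        cases ω.2.sIn iB <;> cases ω.2.sOut iB <;> decide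
      rcases key with hE | hW
      · exact Or.inl ⟨iB, hiB, hfcB, hE⟩
      · exact Or.inr ⟨iB, hiB, hfcB, hW⟩
    rcases hBEW with hBE | hBW
    · -- eastwards in the bottom row: a sixth isolated turn
      obtain ⟨M₆, hW₆, -, hend_M₆⟩ := ω.2.chain_E hX' hBE
      rcases hend_M₆ with ⟨hM₆1, hnotE₆⟩ | ⟨-, hs0⟩ | ⟨-, hsZ⟩
      rotate_left
      · exact absurd hs0 h0E
      · exact absurd hsZ hzE
      obtain ⟨i₆, hi₆, hfc₆, hsv₆, -, -, -, hk₆⟩ := ω.2.isolated_of_usesSide_not_opp (hW₆ M₆ hM₆1 le_rfl) hnotE₆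
      have hP₆ : P (κ.1 + M₆, Y') := by rw [← hfc₆]; exact hPiso i₆ hi₆ hsv₆ hk₆
      have hmem := hall _ hP₆
      simp only [S5, Finset.mem_insert, Finset.mem_singleton, Prod.mk.injEq] at hmem
      rcases hmem with ⟨h1, h2⟩ | ⟨h1, h2⟩ | ⟨h1, h2⟩ | ⟨h1, h2⟩ | h1
      · omega
      · omega
      · omega
      · omega
      · have := congrArg Prod.fst h1; rw [hcolL] at this; simp only at this; omega
    · -- westwards in the bottom row: the partner is the left entry turn, which then needs a sixth isolated turn above it
      obtain ⟨M₆, hE₆, -, hend₆⟩ := ω.2.chain_W hX hBW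
      rcases hend₆ with ⟨hM₆1, hnotW₆⟩ | ⟨hA0, -⟩ | ⟨-, hsZ⟩
      rotate_left
      · rw [h0w] at hA0; have := congrArg Prod.snd hA0; simp only at this; omega
      · exact absurd hsZ hzW
      obtain ⟨i₆, hi₆, hfc₆, hsv₆, -, -, -, hk₆⟩ := ω.2.isolated_of_usesSide_not_opp (hE₆ M₆ hM₆1 le_rfl) hnotW₆
      have hP₆ : P (κ.1 - M₆, Y') := by rw [← hfc₆]; exact hPiso i₆ hi₆ hsv₆ hk₆
      have hmem := hall _ hP₆
      simp only [S5, Finset.mem_insert, Finset.mem_singleton, Prod.mk.injEq] at hmem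
      have hσ : ω.2.fc sL = (κ.1 - M₆, Y') := by
        rcases hmem with ⟨h1, h2⟩ | ⟨h1, h2⟩ | ⟨h1, h2⟩ | ⟨h1, h2⟩ | h1
        · omega
        · omega
        · omega
        · omega
        · exact h1.symm
      -- the left entry turn leaves through `N`
      have hσN : ω.2.sOut sL = .N := by
        rcases houtL with e | e
        · exact e
        · exact absurd e (hSbot sL hsL (by rw [hσ])).2
      obtain ⟨M₇, hS₇, -, hend₇⟩ := ω.2.chain_N hY ⟨sL, hsL, hσ, Or.inr hσN⟩
      rcases hend₇ with ⟨hM₇1, hnotN₇⟩ | ⟨-, hs0⟩ | ⟨hZ, hNo⟩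
      rotate_left
      · exact absurd hs0 h0N
      rotate_right
      · obtain ⟨i₇, hi₇, hfc₇, hsv₇, -, -, -, hk₇⟩ := ω.2.isolated_of_usesSide_not_opp (hS₇ M₇ hM₇1 le_rfl) hnotN₇
        have hP₇ : P (κ.1 - M₆, Y' + M₇) := by rw [← hfc₇]; exact hPiso i₇ hi₇ hsv₇ hk₇
        have hmem₇ := hall _ hP₇
        simp only [S5, Finset.mem_insert, Finset.mem_singleton, Prod.mk.injEq] at hmem₇
        rcases hmem₇ with ⟨h1, h2⟩ | ⟨h1, h2⟩ | ⟨h1, h2⟩ | ⟨h1, h2⟩ | h1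
        · omega
        · omega
        · omega
        · omega
        · rw [hσ] at h1; have := congrArg Prod.snd h1; simp only at this; omega
      · simp only at hZ
        have hr' := hZN (κ.1 - M₆) (Y' + M₇) hZ.symm hNo
        have e1 := congrArg Prod.fst hr'; simp only at e1
        have e2 := congrArg Prod.fst hσ; rw [hcolL] at e2; simp only at e2
        omega
  · ------------------------------------------------------------ CASE `τ` uses `S`: its chain descends to `(τ.1, Y')` (mirror image)
    obtain ⟨Mt, hNt, -, hendt⟩ := ω.2.chain_S hY' hτS
    have hτ' : ω.2.UsesSide (κ.1 + M, Y') .N ∧ ¬ω.2.UsesSide (κ.1 + M, Y') .S := by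
      rcases hendt with ⟨hMt1, hnotS⟩ | ⟨-, hs0⟩ | ⟨hZ, hSo⟩
      rotate_left
      · exact absurd hs0 h0S
      rotate_right
      · obtain ⟨i', hi', hfc', hsv', -, -, -, hk'⟩ := ω.2.isolated_of_usesSide_not_opp (hNt Mt hMt1 le_rfl) hnotS
        have hP' : P (κ.1 + M, κ.2 - Mt) := by rw [← hfc']; exact hPiso i' hi' hsv' hk'
        have hle : Y' ≤ κ.2 - Mt := by have := hY' i' hi'; rw [hfc'] at this; exact this
        rcases lt_or_eq_of_le hle with hlt | heq
        · exfalso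
          have := hmid1 _ _ hP' hPτ hlt (by simp only; omega) hκY' hκY
          have := congrArg Prod.snd this; simp only at this; omega
        · have eY : κ.2 - (Mt : ℤ) = Y' := heq.symm
          simp only at hnotS
          exact ⟨by have := hNt Mt hMt1 le_rfl; simp only at this; rwa [eY] at this, by rwa [eY] at hnotS⟩
      · exfalso
        simp only at hZ
        have hr' := hZS (κ.1 + M) (κ.2 - Mt) hZ.symm hSo
        have := congrArg Prod.snd hr'; simp only at this; omega
    obtain ⟨iτ', hiτ', hfcτ', hsvτ', -, -, -, hkτ'⟩ := ω.2.isolated_of_usesSide_not_opp hτ'.1 hτ'.2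
    have hPτ' : P (κ.1 + M, Y') := by rw [← hfcτ']; exact hPiso iτ' hiτ' hsvτ' hkτ'
    let S5 : Finset Face := {(κ.1 + M, κ.2), (κ.1, Y), (κ.1, Y'), (κ.1 + M, Y'), ω.2.fc sL}
    have hS5P : ∀ f ∈ S5, P f := by
      intro f hf
      simp only [S5, Finset.mem_insert, Finset.mem_singleton] at hf
      rcases hf with rfl | rfl | rfl | rfl | rfl
      · exact hPτ
      · exact hPT
      · exact hPB
      · exact hPτ'
      · exact hPσ
    have hS5card : S5.card = 5 := by
      have hσ1 := hcolL
      simp only [S5]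
      rw [Finset.card_insert_of_notMem, Finset.card_insert_of_notMem, Finset.card_insert_of_notMem,
        Finset.card_insert_of_notMem, Finset.card_singleton]
      · simp only [Finset.mem_singleton]
        intro e; have := congrArg Prod.fst e; simp only at this; omega
      · simp only [Finset.mem_insert, Finset.mem_singleton, Prod.mk.injEq, not_or]
        refine ⟨by omega, fun e => ?_⟩
        have := congrArg Prod.fst e; simp only at this; omega
      · simp only [Finset.mem_insert, Finset.mem_singleton, Prod.mk.injEq, not_or]
        refine ⟨by omega, by omega, fun e => ?_⟩
        have := congrArg Prod.fst e; simp only at this; omega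
      · simp only [Finset.mem_insert, Finset.mem_singleton, Prod.mk.injEq, not_or]
        refine ⟨by omega, by omega, by omega, fun e => ?_⟩
        have := congrArg Prod.fst e; simp only at this; omega
    have hall : ∀ f, P f → f ∈ S5 := by
      intro f hf
      by_contra hnot
      have := hle5 (insert f S5) (fun g hg => by
        rcases Finset.mem_insert.1 hg with rfl | hg
        · exact hf
        · exact hS5P g hg)
      rw [Finset.card_insert_of_notMem hnot, hS5card] at this
      omega
    -- the top turn `(κ.1, Y)` uses `E` or `W`
    have hTEW : ω.2.UsesSide (κ.1, Y) .E ∨ ω.2.UsesSide (κ.1, Y) .W := by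
      have hne := ω.2.sIn_ne_sOut hiT
      have key : (ω.2.sIn iT = .E ∨ ω.2.sOut iT = .E) ∨ (ω.2.sIn iT = .W ∨ ω.2.sOut iT = .W) := by
        revert hST hninT hnoutT hne
        cases ω.2.sIn iT <;> cases ω.2.sOut iT <;> decide
      rcases key with hE | hW
      · exact Or.inl ⟨iT, hiT, hfcT, hE⟩
      · exact Or.inr ⟨iT, hiT, hfcT, hW⟩
    rcases hTEW with hTE | hTW
    · obtain ⟨M₆, hW₆, -, hend_M₆⟩ := ω.2.chain_E hX' hTE
      rcases hend_M₆ with ⟨hM₆1, hnotE₆⟩ | ⟨-, hs0⟩ | ⟨-, hsZ⟩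
      rotate_left
      · exact absurd hs0 h0E
      · exact absurd hsZ hzE
      obtain ⟨i₆, hi₆, hfc₆, hsv₆, -, -, -, hk₆⟩ := ω.2.isolated_of_usesSide_not_opp (hW₆ M₆ hM₆1 le_rfl) hnotE₆
      have hP₆ : P (κ.1 + M₆, Y) := by rw [← hfc₆]; exact hPiso i₆ hi₆ hsv₆ hk₆
      have hmem := hall _ hP₆
      simp only [S5, Finset.mem_insert, Finset.mem_singleton, Prod.mk.injEq] at hmem
      rcases hmem with ⟨h1, h2⟩ | ⟨h1, h2⟩ | ⟨h1, h2⟩ | ⟨h1, h2⟩ | h1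
      · omega
      · omega
      · omega
      · omega
      · have := congrArg Prod.fst h1; rw [hcolL] at this; simp only at this; omega
    · obtain ⟨M₆, hE₆, -, hend₆⟩ := ω.2.chain_W hX hTW
      rcases hend₆ with ⟨hM₆1, hnotW₆⟩ | ⟨hA0, -⟩ | ⟨-, hsZ⟩
      rotate_left
      · rw [h0w] at hA0; have := congrArg Prod.snd hA0; simp only at this; omega
      · exact absurd hsZ hzW
      obtain ⟨i₆, hi₆, hfc₆, hsv₆, -, -, -, hk₆⟩ := ω.2.isolated_of_usesSide_not_opp (hE₆ M₆ hM₆1 le_rfl) hnotW₆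
      have hP₆ : P (κ.1 - M₆, Y) := by rw [← hfc₆]; exact hPiso i₆ hi₆ hsv₆ hk₆
      have hmem := hall _ hP₆
      simp only [S5, Finset.mem_insert, Finset.mem_singleton, Prod.mk.injEq] at hmem
      have hσ : ω.2.fc sL = (κ.1 - M₆, Y) := by
        rcases hmem with ⟨h1, h2⟩ | ⟨h1, h2⟩ | ⟨h1, h2⟩ | ⟨h1, h2⟩ | h1
        · omega
        · omega
        · omega
        · omega
        · exact h1.symm
      -- the left entry turn leaves through `S`
      have hσS : ω.2.sOut sL = .S := by
        rcases houtL with e | e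
        · exact absurd e (hNtop sL hsL (by rw [hσ])).2
        · exact e
      obtain ⟨M₇, hN₇, -, hend₇⟩ := ω.2.chain_S hY' ⟨sL, hsL, hσ, Or.inr hσS⟩
      rcases hend₇ with ⟨hM₇1, hnotS₇⟩ | ⟨-, hs0⟩ | ⟨hZ, hSo⟩
      rotate_left
      · exact absurd hs0 h0S
      rotate_right
      · obtain ⟨i₇, hi₇, hfc₇, hsv₇, -, -, -, hk₇⟩ := ω.2.isolated_of_usesSide_not_opp (hN₇ M₇ hM₇1 le_rfl) hnotS₇
        have hP₇ : P (κ.1 - M₆, Y - M₇) := by rw [← hfc₇]; exact hPiso i₇ hi₇ hsv₇ hk₇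
        have hmem₇ := hall _ hP₇
        simp only [S5, Finset.mem_insert, Finset.mem_singleton, Prod.mk.injEq] at hmem₇
        rcases hmem₇ with ⟨h1, h2⟩ | ⟨h1, h2⟩ | ⟨h1, h2⟩ | ⟨h1, h2⟩ | h1
        · omega
        · omega
        · omega
        · omega
        · rw [hσ] at h1; have := congrArg Prod.snd h1; simp only at this; omega
      · simp only at hZ
        have hr' := hZS (κ.1 - M₆) (Y - M₇) hZ.symm hSo
        have e1 := congrArg Prod.fst hr'; simp only at e1
        have e2 := congrArg Prod.fst hσ; rw [hcolL] at e2; simp only at e2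
        omega

end ΩG

end Literature.Probability.RandomPlanarGeometry.SAW.YangBaxter
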